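import Literature.AlgebraicGeometry.Resolution.CompletedPullbackRegular
import Literature.AlgebraicGeometry.Resolution.BlowupPrincipalCharts
import Mathlib.AlgebraicGeometry.Morphisms.Finite
import Mathlib.RingTheory.AdjoinRoot
import HarnessLib

/-!
# Sections of the pulled-back `p`-cyclic cover over an affine open of the base

Topic: `Literature/AlgebraicGeometry/Resolution`. Scheme-level bookkeeping for the endgame of
the crux `PicoverLocalModel` (purely inseparable `p`-cyclic covers `T^p = a`, J. Giraud,
Bull. SMF 111 (1983); K. Kato, Amer. J. Math. 116 (1994)). For a commutative ring `R`, `a ∈ R`,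
`R_a = R[T]/(T^p - a)`, `μ : Spec R_a → Spec R`, a scheme `π : W → Spec R` and the pulled-back
cover `Y = Spec R_a ×_{Spec R} W` with projection `q = pullback.snd μ π : Y → W`:

* `isAffineOpen_preimage_snd` — `q` is finite, so `q⁻¹(U)` is affine for `U ⊆ W` affine;
* `exists_root_sections_pullback` — over an affine open `U` of `W` there is a section
  `t_Y ∈ Γ(Y, q⁻¹U)` with `t_Y^p = q^*(π^* a)` such that EVERY section over `q⁻¹U` is a
  polynomial in `t_Y` with coefficients from `Γ(W, U)`: through the chart
  `Spec (Γ(W,U) ⊗_R R_a) ≅ q⁻¹(U)` (`specTensorChart` of `CompletedPullbackRegular.lean`) the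
  sections are `Γ(W,U) ⊗_R R_a`, generated over `Γ(W,U)` by `1 ⊗ T`.

Sources: folklore (EGA I, (3.2), fibre products of affine schemes). [Giraud1983] context.
-/

noncomputable section

open CategoryTheory CategoryTheory.Limits AlgebraicGeometry TopologicalSpace Polynomial
open scoped TensorProduct

namespace Literature.AlgebraicGeometry.Resolution

universe u

/-! ## Small lemmas -/

/-- `R → R[T]/(T^p - a)` is injective for `0 < p`. [folklore] -/
theorem adjoinRoot_of_injective {R : Type*} [CommRing R] [Nontrivial R] (p : ℕ) (hp : 0 < p)
    (a : R) : Function.Injective (AdjoinRoot.of ((X : R[X]) ^ p - C a)) := by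
  have hmonic : ((X : R[X]) ^ p - C a).Monic := monic_X_pow_sub_C a hp.ne'
  intro b₁ b₂ hb
  rw [← sub_eq_zero, ← map_sub] at hb
  by_contra hne
  have hne' : b₁ - b₂ ≠ 0 := sub_ne_zero.mpr hne
  change AdjoinRoot.mk _ (C (b₁ - b₂)) = 0 at hb
  rw [AdjoinRoot.mk_eq_zero] at hb
  refine hmonic.not_dvd_of_natDegree_lt (C_ne_zero.mpr hne') ?_ hb
  rw [natDegree_C, natDegree_X_pow_sub_C]
  exact hp

/-- `T^p = a` in `R[T]/(T^p - a)`. [folklore] -/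
theorem adjoinRoot_root_pow {R : Type*} [CommRing R] (p : ℕ) (a : R) :
    AdjoinRoot.root ((X : R[X]) ^ p - C a) ^ p = AdjoinRoot.of ((X : R[X]) ^ p - C a) a := by
  have h := AdjoinRoot.eval₂_root ((X : R[X]) ^ p - C a)
  rwa [eval₂_sub, eval₂_X_pow, eval₂_C, sub_eq_zero] at h

/-- The sections map of `Spec φ` on global sections, in `appLE` form, intertwines the
`ΓSpecIso`s. [folklore] -/
theorem SpecMap_appLE_top_ΓSpecIso_inv {R S : CommRingCat.{u}} (φ : R ⟶ S)
    (e : (⊤ : (Spec S).Opens) ≤ Spec.map φ ⁻¹ᵁ ⊤) (r : R) :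
    (Spec.map φ).appLE ⊤ ⊤ e ((Scheme.ΓSpecIso R).inv r) = (Scheme.ΓSpecIso S).inv (φ r) := by
  have h1 : (Spec.map φ).appLE ⊤ ⊤ e = (Spec.map φ).appTop := Scheme.Hom.appLE_eq_app _
  rw [h1, ← CommRingCat.comp_apply, ← Scheme.ΓSpecIso_inv_naturality, CommRingCat.comp_apply]

/-! ## Generation of `A ⊗_R R[T]/(f)` by `1 ⊗ T` over `A` -/

/-- Every element of `A ⊗_R R[T]/(f)` is a polynomial in `1 ⊗ T` with coefficients `x ⊗ 1`,
`x ∈ A`. [folklore] -/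
theorem exists_eval₂_includeLeft_eq {R A : Type*} [CommRing R] [CommRing A] [Algebra R A]
    (f : R[X]) (τ : A ⊗[R] AdjoinRoot f) :
    ∃ q : A[X], τ = q.eval₂ (Algebra.TensorProduct.includeLeftRingHom : A →+* A ⊗[R] AdjoinRoot f)
      ((1 : A) ⊗ₜ AdjoinRoot.root f) := by
  induction τ using TensorProduct.induction_on with
  | zero => exact ⟨0, by simp⟩
  | tmul x y =>
    obtain ⟨s, rfl⟩ := AdjoinRoot.mk_surjective y
    refine ⟨C x * s.map (algebraMap R A), ?_⟩
    rw [eval₂_mul, eval₂_C, eval₂_map]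
    have hincl : (Algebra.TensorProduct.includeLeftRingHom : A →+* A ⊗[R] AdjoinRoot f).comp
        (algebraMap R A) = algebraMap R (A ⊗[R] AdjoinRoot f) := by
      ext r
      rw [RingHom.comp_apply, Algebra.TensorProduct.includeLeftRingHom_apply,
        Algebra.TensorProduct.algebraMap_apply]
    rw [hincl, ← Polynomial.aeval_def,
      show ((1 : A) ⊗ₜ[R] AdjoinRoot.root f) = Algebra.TensorProduct.includeRight (R := R) (A := A)
        (AdjoinRoot.root f) from rfl, Polynomial.aeval_algHom_apply, AdjoinRoot.aeval_eq,
      Algebra.TensorProduct.includeRight_apply, Algebra.TensorProduct.includeLeftRingHom_apply,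
      Algebra.TensorProduct.tmul_mul_tmul, mul_one, one_mul]
  | add τ₁ τ₂ h₁ h₂ =>
    obtain ⟨q₁, rfl⟩ := h₁
    obtain ⟨q₂, rfl⟩ := h₂
    exact ⟨q₁ + q₂, by rw [eval₂_add]⟩

/-! ## The pulled-back cover over an affine open -/

section Cover

variable {R : Type u} [CommRing R] (p : ℕ) [hp : Fact p.Prime] (a : R) {W : Scheme.{u}}
  (π : W ⟶ Spec (.of R))

/-- `Spec R[T]/(T^p - a) → Spec R` is finite. [folklore] -/
theorem isFinite_SpecMap_adjoinRoot :
    IsFinite (Spec.map (CommRingCat.ofHom (algebraMap R (AdjoinRoot ((X : R[X]) ^ p - C a))))) := by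
  rw [IsFinite.SpecMap_iff, CommRingCat.hom_ofHom, RingHom.finite_algebraMap]
  exact (monic_X_pow_sub_C a hp.out.ne_zero).finite_adjoinRoot

/-- `Spec R[T]/(T^p - a) → Spec R` is surjective (lying over). [folklore] -/
theorem surjective_SpecMap_adjoinRoot :
    Surjective (Spec.map (CommRingCat.ofHom (algebraMap R (AdjoinRoot ((X : R[X]) ^ p - C a))))) := by
  haveI : Module.Finite R (AdjoinRoot ((X : R[X]) ^ p - C a)) :=
    (monic_X_pow_sub_C a hp.out.ne_zero).finite_adjoinRoot
  refine ⟨fun x => ?_⟩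
  cases subsingleton_or_nontrivial R with
  | inl h =>
    exact (IsEmpty.false (α := PrimeSpectrum R) x).elim
  | inr h =>
    have hint : (algebraMap R (AdjoinRoot ((X : R[X]) ^ p - C a))).IsIntegral :=
      Algebra.IsIntegral.isIntegral
    obtain ⟨q, hq⟩ := hint.comap_surjective (adjoinRoot_of_injective p hp.out.pos a) x
    exact ⟨q, hq⟩

/-- The projection `Y = Spec R_a ×_{Spec R} W → W` is finite, hence affine: the preimage of an
affine open is affine. [folklore] -/
theorem isAffineOpen_preimage_snd (U : W.affineOpens) :
    IsAffineOpen (pullback.snd (Spec.map (CommRingCat.ofHom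
      (algebraMap R (AdjoinRoot ((X : R[X]) ^ p - C a))))) π ⁻¹ᵁ (U : W.Opens)) :=
  haveI := isFinite_SpecMap_adjoinRoot p a
  U.2.preimage _

omit hp in
/-- **Sections of the pulled-back cover over an affine open.** Over an affine open `U ⊆ W`
there is `t_Y ∈ Γ(Y, q⁻¹U)` (`q : Y → W` the projection) with `t_Y^p = q^* π^* a`, and every
section over `q⁻¹U` is a polynomial in `t_Y` with coefficients pulled back from `Γ(W, U)`.
[folklore] -/
theorem exists_root_sections_pullback (U : W.affineOpens) :
    ∃ tY : Γ(pullback (Spec.map (CommRingCat.ofHom (algebraMap R (AdjoinRoot ((X : R[X]) ^ p - C a))))) π,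
        pullback.snd (Spec.map (CommRingCat.ofHom (algebraMap R (AdjoinRoot ((X : R[X]) ^ p - C a))))) π ⁻¹ᵁ (U : W.Opens)),
      tY ^ p = (pullback.snd (Spec.map (CommRingCat.ofHom (algebraMap R (AdjoinRoot ((X : R[X]) ^ p - C a))))) π).app U
        (π.appLE ⊤ U le_top ((Scheme.ΓSpecIso (.of R)).inv a)) ∧
      ∀ b, ∃ q : Γ(W, U)[X], b = q.eval₂ ((pullback.snd (Spec.map (CommRingCat.ofHom
        (algebraMap R (AdjoinRoot ((X : R[X]) ^ p - C a))))) π).app U).hom tY := by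
  set μ := Spec.map (CommRingCat.ofHom (algebraMap R (AdjoinRoot ((X : R[X]) ^ p - C a)))) with hμ
  set Y := pullback μ π with hY
  set q := pullback.snd μ π with hq
  -- the `R`-algebra structure of `A = Γ(W, U)`
  letI algA : Algebra R Γ(W, U) := (Spec.preimage (U.2.fromSpec ≫ π)).hom.toAlgebra
  have hi : U.2.fromSpec ≫ π = Spec.map (CommRingCat.ofHom (algebraMap R Γ(W, U))) := by
    rw [RingHom.algebraMap_toAlgebra, CommRingCat.ofHom_hom, Spec.map_preimage]
  -- the chart
  set T := Γ(W, U) ⊗[R] (AdjoinRoot ((X : R[X]) ^ p - C a)) with hT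
  let c : Spec (.of T) ⟶ pullback π μ := specTensorChart (AdjoinRoot ((X : R[X]) ^ p - C a)) π U.2.fromSpec hi
  let c' : Spec (.of T) ⟶ Y := c ≫ (pullbackSymmetry μ π).inv
  have hc'snd : c' ≫ q = Spec.map (CommRingCat.ofHom
      (Algebra.TensorProduct.includeLeftRingHom (R := R) (A := Γ(W, U)) (B := (AdjoinRoot ((X : R[X]) ^ p - C a))))) ≫ U.2.fromSpec := by
    simp only [c', c, hq, Category.assoc, pullbackSymmetry_inv_comp_snd]
    exact specTensorChart_fst (AdjoinRoot ((X : R[X]) ^ p - C a)) π U.2.fromSpec hi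
  have hc'fst : c' ≫ pullback.fst μ π = Spec.map (CommRingCat.ofHom (RingHomClass.toRingHom
      (Algebra.TensorProduct.includeRight (R := R) (A := Γ(W, U)) (B := (AdjoinRoot ((X : R[X]) ^ p - C a)))))) := by
    simp only [c', c, Category.assoc, pullbackSymmetry_inv_comp_fst]
    exact specTensorChart_snd (AdjoinRoot ((X : R[X]) ^ p - C a)) π U.2.fromSpec hi
  set V : Y.Opens := q ⁻¹ᵁ (U : W.Opens) with hV
  have hpre : c' ⁻¹ᵁ V = ⊤ := by
    rw [hV, ← Scheme.Hom.comp_preimage, hc'snd, Scheme.Hom.comp_preimage, U.2.fromSpec_preimage_self]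
    rfl
  have hVrange : V ≤ c'.opensRange := by
    intro y hy
    have hy' : pullback.fst π μ ((pullbackSymmetry μ π).hom y) ∈ Set.range U.2.fromSpec := by
      rw [U.2.range_fromSpec, ← Scheme.Hom.comp_apply, pullbackSymmetry_hom_comp_fst]
      exact hy
    have : (pullbackSymmetry μ π).hom y ∈ Set.range c := by
      change _ ∈ Set.range (specTensorChart (AdjoinRoot ((X : R[X]) ^ p - C a)) π U.2.fromSpec hi)
      rw [range_specTensorChart]
      exact hy'
    obtain ⟨s, hs⟩ := this
    refine ⟨s, ?_⟩
    change (c ≫ (pullbackSymmetry μ π).inv) s = y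
    rw [Scheme.Hom.comp_apply, hs, ← Scheme.Hom.comp_apply, Iso.hom_inv_id]
    rfl
  -- the sections map `θ : Γ(Y, V) → T`
  let Λ : Γ(Y, V) ⟶ Γ(Spec (.of T), ⊤) := c'.appLE V ⊤ hpre.ge
  let θ : Γ(Y, V) ⟶ CommRingCat.of T := Λ ≫ (Scheme.ΓSpecIso (.of T)).hom
  -- `θ` is injective
  have hΛiso : IsIso Λ := by
    haveI := c'.isIso_app V hVrange
    haveI : IsIso (homOfLE hpre.ge : (⊤ : (Spec (.of T)).Opens) ⟶ c' ⁻¹ᵁ V) :=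
      ⟨⟨homOfLE hpre.le, Subsingleton.elim _ _, Subsingleton.elim _ _⟩⟩
    change IsIso (c'.app V ≫ (Spec (.of T)).presheaf.map (homOfLE hpre.ge).op)
    infer_instance
  have hθinj : Function.Injective θ := by
    haveI := hΛiso
    exact ((ConcreteCategory.bijective_of_isIso (Λ ≫ (Scheme.ΓSpecIso (.of T)).hom))).1
  -- `θ ∘ q^* = includeLeft`
  have hθA : ∀ x : Γ(W, U), θ (q.app U x) = x ⊗ₜ (1 : (AdjoinRoot ((X : R[X]) ^ p - C a))) := by
    intro x
    have h1 : q.app U ≫ Λ = (c' ≫ q).appLE U ⊤ (by rw [Scheme.Hom.comp_preimage, hpre]) := by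
      rw [Scheme.Hom.comp_appLE]
    rw [appLE_congr_hom hc'snd (U : W.Opens) ⊤ _] at h1
    have h3 := (Scheme.Hom.appLE_comp_appLE (Spec.map (CommRingCat.ofHom
      (Algebra.TensorProduct.includeLeftRingHom (R := R) (A := Γ(W, U)) (B := (AdjoinRoot ((X : R[X]) ^ p - C a))))))
      U.2.fromSpec (U : W.Opens) ⊤ ⊤ (by rw [U.2.fromSpec_preimage_self]) le_top)
    rw [fromSpec_appLE_top U] at h3
    change (Scheme.ΓSpecIso (.of T)).hom (Λ (q.app U x)) = _
    rw [← CommRingCat.comp_apply (q.app U) Λ, h1, ← h3, CommRingCat.comp_apply]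
    erw [SpecMap_appLE_top_ΓSpecIso_inv]
    rw [← CommRingCat.comp_apply, Iso.inv_hom_id]
    rfl
  -- the root section
  let tY : Γ(Y, V) := (pullback.fst μ π).appLE ⊤ V le_top ((Scheme.ΓSpecIso (.of (AdjoinRoot ((X : R[X]) ^ p - C a)))).inv
    (AdjoinRoot.root _))
  have hθt : θ tY = (1 : Γ(W, U)) ⊗ₜ AdjoinRoot.root ((X : R[X]) ^ p - C a) := by
    have h1 := Scheme.Hom.appLE_comp_appLE c' (pullback.fst μ π) ⊤ V ⊤ le_top hpre.ge
    rw [appLE_congr_hom hc'fst ⊤ ⊤ _] at h1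
    change (Scheme.ΓSpecIso (.of T)).hom (Λ ((pullback.fst μ π).appLE ⊤ V le_top _)) = _
    rw [← CommRingCat.comp_apply ((pullback.fst μ π).appLE ⊤ V le_top) Λ, h1]
    erw [SpecMap_appLE_top_ΓSpecIso_inv]
    rw [← CommRingCat.comp_apply, Iso.inv_hom_id]
    rfl
  -- `t_Y^p = q^* π^* a`
  have htYp : tY ^ p = q.app U (π.appLE ⊤ U le_top ((Scheme.ΓSpecIso (.of R)).inv a)) := by
    have h0 : ((Scheme.ΓSpecIso (.of (AdjoinRoot ((X : R[X]) ^ p - C a)))).inv (AdjoinRoot.root _)) ^ p =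
        (Scheme.ΓSpecIso (.of (AdjoinRoot ((X : R[X]) ^ p - C a)))).inv (algebraMap R (AdjoinRoot ((X : R[X]) ^ p - C a)) a) := by
      rw [← map_pow, adjoinRoot_root_pow]; rfl
    have h1 : (Scheme.ΓSpecIso (.of (AdjoinRoot ((X : R[X]) ^ p - C a)))).inv (algebraMap R (AdjoinRoot ((X : R[X]) ^ p - C a)) a) =
        μ.appLE ⊤ ⊤ le_top ((Scheme.ΓSpecIso (.of R)).inv a) := by
      rw [hμ, SpecMap_appLE_top_ΓSpecIso_inv]; rfl
    have h2 := Scheme.Hom.appLE_comp_appLE (pullback.fst μ π) μ ⊤ ⊤ V le_top le_top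
    rw [appLE_congr_hom pullback.condition ⊤ V _] at h2
    have h4 := Scheme.Hom.appLE_comp_appLE q π ⊤ (U : W.Opens) V le_top le_rfl
    change ((pullback.fst μ π).appLE ⊤ V le_top _) ^ p = _
    rw [← map_pow, h0, h1, ← CommRingCat.comp_apply, h2, ← h4, CommRingCat.comp_apply,
      Scheme.Hom.appLE_eq_app]
  refine ⟨tY, htYp, fun b => ?_⟩
  obtain ⟨qp, hqp⟩ := exists_eval₂_includeLeft_eq ((X : R[X]) ^ p - C a) (θ b)
  refine ⟨qp, hθinj ?_⟩
  rw [hqp, Polynomial.hom_eval₂, hθt]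
  congr 1
  ext x
  exact (hθA x).symm

end Cover

end Literature.AlgebraicGeometry.Resolution

end
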